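import Summits.QuantumFields.YangMills.Theorems.BalabanUVNodesN15KingModelAnalyticBlockCovHolomorphy
import Summits.QuantumFields.YangMills.Theorems.BalabanUVNodesN15KingModelAnalyticSharp
import HarnessLib

/-!
# BalabanUVNodes ∕ N15 — THE KING-MODEL RUNG (PART Ϫ-i): THE WINDOW OF NE2's UNIT LAYER IS EXACTLY THE WINDOW OF THE CONTINUED FINE COVARIANCE — POLES — wherever King's ∕ Bałaban's
# full operator `A(U,V)` is invertible (`a ≠ 0`), ★★★★ `Δ_eff(U,V)` IS INVERTIBLE IFF `B(U,V) = −cΔ_{U,V} + m²` IS: a kernel vector `v` of `B` is carried to the kernel vector `Q(U)v ≠ 0`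
# of `Δ_eff(U,V)` (and `A⁻¹Q♯_K(V)g` carries `ker Δ_eff` back to `ker B`); with PART Ϩ-j's singular dilation `U = a♯·1`, `a♯ − 1 ≤ 3√m²∕L`, and the `m²`-INDEPENDENT flat window `s₀(γ_A,a,d)∕L`
# of `Δ_eff` (PART Ϩ-g at the pure gauge `U₀ ≡ 1`): ★★★★ for `3√m² ≤ s₀(γ_A,a,d)` NE2's unit layer `(Δ_eff(U,U⁻¹))⁻¹` HAS A POLE INSIDE THE HOLOMORPHY POLYDISC OF `Δ_eff(U,U⁻¹)` — the
# block-spin mass `γ_A` protects the effective Laplacian but NOT its inverse, whose radius is pinched by the FINE MASS: `s₀(m²,a,d)·η ≤ radius ≤ 3√m²·η`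
# (Track A, DAG node N15 = NE2; FAN-OUT v1.1 §N15 s3 «KING-MODEL RUNG … + what the curved case adds»; count-neutral)

HONEST FRAMING.  Count-neutral (cell `pub-ymgap`, seat `pub-ymgap-dag-n15-e` g52; `--supports stmt-QuantumFields-27247 --as helper` = K3ᴬ, KEY MAP v3).  King's one-level comparison model,
any fibre `𝕜ⁿ` (nonempty for the witness), King's scaling `c = L²`; §1 is pure linear algebra at every two-sided complex field; §2 uses PART Ϩ-j's constant complex scalar field (a dilation
of the trivial background) and the tree's flat floor `γ_A = gamA a (d+1)` (King ∕ Dimock, `m²`-independent).  The smallness `3√m² ≤ s₀(γ_A,a,d)` is an explicit hypothesis (true for all small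
`m²` at fixed `a, d`).  NOT Bałaban's multi-level objects; NOT a node discharge (N15 of record untouched); nothing continuum ∕ ℝ⁴ ∕ OS ∕ Clay.

THE RESULTS:
* §1 KERNELS (every `U, V`, `a ≠ 0`): `cxFullOp_mulVec_of_ker_zero` (`Bv = 0` ⟹ `A v = a·Q♯_K(V)Q(U)v`), ★★★ **`cxEffLap_mulVec_covQ_of_ker_zero`** (`IsUnit A`, `Bv = 0` ⟹ `Δ_eff(U,V)(Q(U)v) = 0`),
  ★★ `covQ_mulVec_ne_zero_of_ker_zero` (`v ≠ 0` ⟹ `Q(U)v ≠ 0`), ★★ `cxFullOp_zero_mulVec_of_ker_effLap` (`Δ_eff g = 0` ⟹ `B(A⁻¹Q♯_K(V)g) = 0`), ★★★★ **`not_isUnit_cxEffLap_of_not_isUnit_zero`**,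
  ★★★ `not_isUnit_zero_of_not_isUnit_cxEffLap`, ★★★★ **`isUnit_cxEffLap_iff_isUnit_zero`** (`IsUnit A(U,V)`, `a ≠ 0`: `IsUnit Δ_eff(U,V) ↔ IsUnit B(U,V)`).
* §2 THE POLE (nonempty fibre, `L ≥ 1`, contours of depth `≤ (d+1)(L−1)`, `a > 0`, `0 < m² ≤ 2(d+1)L²`, `3√m² ≤ s₀(γ_A,a,d)`): `isUnit_cxFullOp_dilation` (`A(a♯1,(a♯1)⁻¹)` IS invertible — inside the flat
  window), ★★★★ **`not_isUnit_cxEffLap_slice_dilation`** (`Δ_eff(a♯1,(a♯1)⁻¹)` is NOT), ★★★★ **`blockCov_pole_inside_effLap_polydisc`** (∃ `U` with `‖U_b − 1‖ ≤ 3√m²∕L`: `A(U,U⁻¹)` invertible,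
  `Δ_eff` analytic at `U`, but `B(U,U⁻¹)` and `Δ_eff(U,U⁻¹)` singular), ★★★ `not_forall_isUnit_cxEffLap_closedPolydisc` (no closed polydisc of radius `≥ 3√m²∕L` around `1` is a window for
  NE2's unit layer), ★★ `blockCov_radius_pinched` (`s₀(m²,a,d) ≤ 3√m²` under the hypotheses — the two certified orders are consistent).
PRIOR TREE ART (by name): Ϫ-a (`cxFullOp_eq_zero_add_blockTerm`, `cxEffLap_mul_cxBlockCov`, `isUnit_cxEffLap_of_isUnit`), Ϫ-b (`sliceRadius_anti`), Ϫ-d (`analyticOnNhd_printEffLap_polydisc`), Ϩ-j (`not_isUnit_cxFullOp_slice_dilation`,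
`edgeDil_sub_one_le`, `norm_dilation_sub_one_le`), Ϛ-d (`edgeDil`, `edgeDil_gt`), Ϩ-g (`sliceRadius`, `sliceRadius_le`, `isUnit_cxFullOp_at_radius`), Ϥ-p (`re_quadForm_fullOpU_const_one_ge_gamA`), King1986 (`gamA`, `gamA_pos`),
Mathlib (`Matrix.exists_mulVec_eq_zero_iff`, `Matrix.isUnit_iff_isUnit_det`).  Dedup (rg at filing): basename 0 files; needles `isUnit_cxEffLap_iff|blockCov_pole|cxEffLap_mulVec_covQ_of_ker` 0 tree files.
Locators: [King1986] (2.13)–(2.14) p.653, (4.44)–(4.45) p.675; [Balaban1985BackgroundPropagators] (3.24)–(3.25) p.394, §3.B p.399 l.37–40, Thm 3.4 p.400; [Dimock2013] App. D Lemma 29.  0 `sorry`, 0 `def`.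
-/

noncomputable section
open scoped BigOperators ComplexConjugate ComplexOrder Matrix.Norms.L2Operator
open Finset Matrix

namespace Summit.QuantumFields.YangMills.BalabanUVNodes.N15KingModelRung.Analytic

open Literature.MathematicalPhysics.QuantumFieldTheory.Balaban1983to89.B5Prop11Plancherel (Tor fine)
open Literature.MathematicalPhysics.QuantumFieldTheory.King1986.Torus (gamA gamA_pos)
open Summit.QuantumFields.YangMills.BalabanUVNodes.N15KingModelRung.Covariant (fib edgeDil edgeDil_gt edgeEps)
open Summit.QuantumFields.YangMills.BalabanUVNodes.N15KingModelRung.CovariantBlock (BlockTree covQ fullOpU re_quadForm_fullOpU_const_one_ge_gamA)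

variable {d : ℕ} {L : ℕ} [NeZero L] (T : BlockTree d L) (M : Fin (d + 1) → ℕ) [hM : ∀ μ, NeZero (M μ)]
variable {𝕜 : Type*} [RCLike 𝕜] {n : Type*} [Fintype n] [DecidableEq n]

/-! ## §1 Kernels: `ker B(U,V) → ker Δ_eff(U,V)` via `Q(U)`, and back via `A⁻¹Q♯_K(V)` -/

section Kernels

variable {a c m2 : ℝ} {U V : Tor (fine L M) × Fin (d + 1) → Matrix n n 𝕜}

/-- `Bv = 0` ⟹ `A(U,V)v = a·Q♯_K(V)(Q(U)v)` (`A = B + a·Q♯_K Q`). [cite: King1986, (2.13) p.653; Balaban1985BackgroundPropagators, (3.24) p.394] -/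
theorem cxFullOp_mulVec_of_ker_zero {v : Tor (fine L M) × n → 𝕜} (hv : cxFullOp T M 0 c m2 U V *ᵥ v = 0) :
    cxFullOp T M a c m2 U V *ᵥ v = (a : 𝕜) • (cxKingQadj T M V *ᵥ (covQ T M U *ᵥ v)) := by
  rw [cxFullOp_eq_zero_add_blockTerm, Matrix.add_mulVec, hv, zero_add, Matrix.smul_mulVec, Matrix.mulVec_mulVec]

/-- ★★★ **A KERNEL VECTOR OF THE CONTINUED FINE OPERATOR GIVES A KERNEL VECTOR OF `Δ_eff`**: `A(U,V)` invertible, `B(U,V)v = 0` ⟹ `Δ_eff(U,V)(Q(U)v) = 0` — for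
`a²Q A⁻¹Q♯_K(Qv) = aQ A⁻¹(Av) = aQv`. [cite: King1986, (2.14) p.653, (4.44)–(4.45) p.675] -/
theorem cxEffLap_mulVec_covQ_of_ker_zero (hA : IsUnit (cxFullOp T M a c m2 U V)) {v : Tor (fine L M) × n → 𝕜} (hv : cxFullOp T M 0 c m2 U V *ᵥ v = 0) :
    cxEffLap T M a c m2 U V *ᵥ (covQ T M U *ᵥ v) = 0 := by
  have hGA : (cxFullOp T M a c m2 U V)⁻¹ * cxFullOp T M a c m2 U V = 1 := Matrix.nonsing_inv_mul _ ((Matrix.isUnit_iff_isUnit_det _).mp hA)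
  have hback : (cxFullOp T M a c m2 U V)⁻¹ *ᵥ (cxKingQadj T M V *ᵥ (covQ T M U *ᵥ v)) = ((a : 𝕜))⁻¹ • v ∨ (a : 𝕜) = 0 := by
    by_cases ha : (a : 𝕜) = 0
    · exact Or.inr ha
    · left
      have h := cxFullOp_mulVec_of_ker_zero T M (a := a) hv
      have h2 : (cxFullOp T M a c m2 U V)⁻¹ *ᵥ (cxFullOp T M a c m2 U V *ᵥ v) = v := by rw [Matrix.mulVec_mulVec, hGA, Matrix.one_mulVec]
      rw [h, Matrix.mulVec_smul] at h2
      calc (cxFullOp T M a c m2 U V)⁻¹ *ᵥ (cxKingQadj T M V *ᵥ (covQ T M U *ᵥ v))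
          = ((a : 𝕜))⁻¹ • ((a : 𝕜) • ((cxFullOp T M a c m2 U V)⁻¹ *ᵥ (cxKingQadj T M V *ᵥ (covQ T M U *ᵥ v)))) := by rw [smul_smul, inv_mul_cancel₀ ha, one_smul]
        _ = ((a : 𝕜))⁻¹ • v := by rw [h2]
  rw [cxEffLap, Matrix.sub_mulVec, Matrix.smul_mulVec, Matrix.one_mulVec, Matrix.smul_mulVec, ← Matrix.mulVec_mulVec, ← Matrix.mulVec_mulVec]
  rcases hback with h | ha0
  · rw [h, Matrix.mulVec_smul, smul_smul, show ((a ^ 2 : ℝ) : 𝕜) * ((a : 𝕜))⁻¹ = (a : 𝕜) by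
      by_cases ha : (a : 𝕜) = 0
      · have : a = 0 := by exact_mod_cast ha
        simp [this]
      · push_cast; field_simp]
    exact sub_self _
  · have : a = 0 := by exact_mod_cast ha0
    subst this
    simp

/-- ★★ **… AND IT IS NONZERO**: `A(U,V)` invertible, `v ≠ 0`, `B(U,V)v = 0` ⟹ `Q(U)v ≠ 0` (else `Av = Bv + aQ♯_K(Qv) = 0`). [cite: Balaban1985BackgroundPropagators, (3.24)–(3.25) p.394] -/
theorem covQ_mulVec_ne_zero_of_ker_zero (hA : IsUnit (cxFullOp T M a c m2 U V)) {v : Tor (fine L M) × n → 𝕜} (hv0 : v ≠ 0) (hv : cxFullOp T M 0 c m2 U V *ᵥ v = 0) :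
    covQ T M U *ᵥ v ≠ 0 := by
  intro hQ
  have hAv : cxFullOp T M a c m2 U V *ᵥ v = 0 := by rw [cxFullOp_mulVec_of_ker_zero T M (a := a) hv, hQ, Matrix.mulVec_zero, smul_zero]
  have hdet : (cxFullOp T M a c m2 U V).det ≠ 0 := ((Matrix.isUnit_iff_isUnit_det _).mp hA).ne_zero
  exact hdet (Matrix.exists_mulVec_eq_zero_iff.mp ⟨v, hv0, hAv⟩)

/-- ★★ **BACKWARDS: A KERNEL VECTOR OF `Δ_eff` GIVES A KERNEL VECTOR OF `B`**: `a ≠ 0`, `A` invertible, `Δ_eff(U,V)g = 0` ⟹ `B(U,V)(A⁻¹Q♯_K(V)g) = 0`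
(`B A⁻¹Yg = Yg − aYXA⁻¹Yg = Y·a⁻¹Δ_eff g`). [cite: King1986, (2.14) p.653, (4.44)–(4.45) p.675] -/
theorem cxFullOp_zero_mulVec_of_ker_effLap (ha : a ≠ 0) (hA : IsUnit (cxFullOp T M a c m2 U V)) {g : Tor M × n → 𝕜} (hg : cxEffLap T M a c m2 U V *ᵥ g = 0) :
    cxFullOp T M 0 c m2 U V *ᵥ ((cxFullOp T M a c m2 U V)⁻¹ *ᵥ (cxKingQadj T M V *ᵥ g)) = 0 := by
  have ha' : (a : 𝕜) ≠ 0 := by exact_mod_cast ha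
  have hAG : cxFullOp T M a c m2 U V * (cxFullOp T M a c m2 U V)⁻¹ = 1 := Matrix.mul_nonsing_inv _ ((Matrix.isUnit_iff_isUnit_det _).mp hA)
  set G := (cxFullOp T M a c m2 U V)⁻¹ with hG
  set Y := cxKingQadj T M V with hY
  set X := covQ T M U with hX
  -- `B = A − a·YX`
  have hB : cxFullOp T M 0 c m2 U V = cxFullOp T M a c m2 U V - (a : 𝕜) • (Y * X) := by rw [cxFullOp_eq_zero_add_blockTerm T M a c m2 U V, add_sub_cancel_right]
  -- from `Δ_eff g = 0`: `a·g = a²·X G Y g`, i.e. `g = a·X(G(Yg))`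
  have hΔ : (a : 𝕜) • g = ((a ^ 2 : ℝ) : 𝕜) • (X *ᵥ (G *ᵥ (Y *ᵥ g))) := by
    have h := hg
    rw [cxEffLap, Matrix.sub_mulVec, Matrix.smul_mulVec, Matrix.one_mulVec, Matrix.smul_mulVec, ← Matrix.mulVec_mulVec, ← Matrix.mulVec_mulVec, sub_eq_zero] at h
    exact h
  have hsc : ((a : 𝕜))⁻¹ * ((a ^ 2 : ℝ) : 𝕜) = (a : 𝕜) := by push_cast; field_simp
  have hg' : g = (a : 𝕜) • (X *ᵥ (G *ᵥ (Y *ᵥ g))) := by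
    have h2 := congrArg (fun w => ((a : 𝕜))⁻¹ • w) hΔ
    simp only [smul_smul, inv_mul_cancel₀ ha', one_smul, hsc] at h2
    exact h2
  rw [hB, Matrix.sub_mulVec, Matrix.mulVec_mulVec, hAG, Matrix.one_mulVec, Matrix.smul_mulVec, ← Matrix.mulVec_mulVec]
  have key : Y *ᵥ ((a : 𝕜) • (X *ᵥ (G *ᵥ (Y *ᵥ g)))) = Y *ᵥ g := by rw [← hg']
  rw [Matrix.mulVec_smul] at key
  rw [key, sub_self]

/-- ★★★★ **A POLE OF THE CONTINUED FINE COVARIANCE IS A POLE OF NE2's UNIT LAYER**: `a ≠ 0`, `A(U,V)` invertible, `B(U,V)` NOT invertible ⟹ `Δ_eff(U,V)` NOT invertible.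
[cite: King1986, (2.14) p.653, (4.44)–(4.45) p.675; Balaban1985BackgroundPropagators, Thm 3.4 p.400] -/
theorem not_isUnit_cxEffLap_of_not_isUnit_zero (hA : IsUnit (cxFullOp T M a c m2 U V)) (hB : ¬ IsUnit (cxFullOp T M 0 c m2 U V)) : ¬ IsUnit (cxEffLap T M a c m2 U V) := by
  have hdetB : (cxFullOp T M 0 c m2 U V).det = 0 := by
    by_contra h
    exact hB ((Matrix.isUnit_iff_isUnit_det _).mpr (isUnit_iff_ne_zero.mpr h))
  obtain ⟨v, hv0, hv⟩ := Matrix.exists_mulVec_eq_zero_iff.mpr hdetB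
  intro hΔ
  have hdetΔ : (cxEffLap T M a c m2 U V).det ≠ 0 := ((Matrix.isUnit_iff_isUnit_det _).mp hΔ).ne_zero
  exact hdetΔ (Matrix.exists_mulVec_eq_zero_iff.mp ⟨covQ T M U *ᵥ v, covQ_mulVec_ne_zero_of_ker_zero T M hA hv0 hv, cxEffLap_mulVec_covQ_of_ker_zero T M hA hv⟩)

/-- ★★★ **… AND CONVERSELY** (`a ≠ 0`): `A(U,V)` invertible, `Δ_eff(U,V)` NOT invertible ⟹ `B(U,V)` NOT invertible (contrapositive of PART Ϫ-a's Woodbury). [cite: King1986, (4.44)–(4.45) p.675] -/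
theorem not_isUnit_zero_of_not_isUnit_cxEffLap (ha : a ≠ 0) (hA : IsUnit (cxFullOp T M a c m2 U V)) (hΔ : ¬ IsUnit (cxEffLap T M a c m2 U V)) : ¬ IsUnit (cxFullOp T M 0 c m2 U V) :=
  fun hB => hΔ (isUnit_cxEffLap_of_isUnit T M ha hA hB)

/-- ★★★★ **THE WINDOW OF NE2's UNIT LAYER IS EXACTLY THE WINDOW OF THE CONTINUED FINE COVARIANCE**: wherever `A(U,V)` is invertible and `a ≠ 0`,
`Δ_eff(U,V)` is invertible ↔ `B(U,V) = −cΔ_{U,V} + m²` is invertible. [cite: King1986, (2.14) p.653, (4.44)–(4.45) p.675; Balaban1985BackgroundPropagators, Thm 3.4 p.400] -/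
theorem isUnit_cxEffLap_iff_isUnit_zero (ha : a ≠ 0) (hA : IsUnit (cxFullOp T M a c m2 U V)) : IsUnit (cxEffLap T M a c m2 U V) ↔ IsUnit (cxFullOp T M 0 c m2 U V) :=
  ⟨fun hΔ => by by_contra hB; exact not_isUnit_cxEffLap_of_not_isUnit_zero T M hA hB hΔ, fun hB => isUnit_cxEffLap_of_isUnit T M ha hA hB⟩

end Kernels

/-! ## §2 The pole of NE2's unit layer inside the holomorphy polydisc of `Δ_eff` -/

section Pole

variable [Nonempty n] (hD : ∀ j, T.depth j ≤ (d + 1) * (L - 1)) (hL : 1 ≤ L) {a m2 : ℝ} (ha : 0 < a) (hm : 0 < m2) (hmL : m2 ≤ 2 * ((d : ℝ) + 1) * (L : ℝ) ^ 2)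
variable (hsmall : 3 * Real.sqrt m2 ≤ sliceRadius (gamA a (d + 1)) a d)
include hD hL ha hm hmL hsmall

omit [NeZero L] hM [Nonempty n] hD ha hsmall in
/-- PART Ϩ-j's dilated field sits within `3√m²∕L` of the trivial background on every bond. [cite: Balaban1985BackgroundPropagators, Thm 3.4 p.400] -/
theorem norm_dilationField_sub_one_le (bd : Tor (fine L M) × Fin (d + 1)) :
    ‖(fun _ : Tor (fine L M) × Fin (d + 1) => (((edgeDil d ((L : ℝ) ^ 2) m2 : ℝ) : 𝕜)) • (1 : Matrix n n 𝕜)) bd - (fun _ => (1 : Matrix n n 𝕜)) bd‖ ≤ 3 * Real.sqrt m2 / L := by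
  have hL0 : (0 : ℝ) < L := by exact_mod_cast hL
  have hgt := edgeDil_gt (d := d) (by positivity : (0 : ℝ) < (L : ℝ) ^ 2) hm
  have hε0 : 0 ≤ edgeEps d ((L : ℝ) ^ 2) m2 := by unfold edgeEps; positivity
  exact (norm_dilation_sub_one_le (by linarith)).trans (edgeDil_sub_one_le hL hm hmL)

omit [Nonempty n] in
/-- THE FULL OPERATOR IS INVERTIBLE AT THE DILATED FIELD: it lies inside the `m²`-independent flat window `Lε ≤ s₀(γ_A,a,d)` of PART Ϩ-g at `U₀ ≡ 1` (`γ_A = gamA a (d+1)`, King ∕ Dimock).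
[cite: Balaban1985BackgroundPropagators, Thm 3.4 p.400; King1986, (4.33) p.674; Dimock2013, App. D Lemma 29] -/
theorem isUnit_cxFullOp_dilation :
    IsUnit (cxFullOp T M a ((L : ℝ) ^ 2) m2 (fun _ : Tor (fine L M) × Fin (d + 1) => (((edgeDil d ((L : ℝ) ^ 2) m2 : ℝ) : 𝕜)) • (1 : Matrix n n 𝕜))
      (fun bd => ((fun _ : Tor (fine L M) × Fin (d + 1) => (((edgeDil d ((L : ℝ) ^ 2) m2 : ℝ) : 𝕜)) • (1 : Matrix n n 𝕜)) bd)⁻¹)) := by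
  have hL0 : (0 : ℝ) < L := by exact_mod_cast hL
  refine isUnit_cxFullOp_at_radius T M hD ha.le hm.le hL (U₀ := fun _ => (1 : Matrix n n 𝕜)) (fun _ => Submonoid.one_mem _) (gamA_pos ha (d + 1))
    (re_quadForm_fullOpU_const_one_ge_gamA T M hL ha.le hm.le) (ε := 3 * Real.sqrt m2 / L) (by positivity) (norm_dilationField_sub_one_le M hL hm hmL) ?_
  rw [mul_div_cancel₀ _ hL0.ne']
  exact hsmall

/-- ★★★★ **KING's CONTINUED EFFECTIVE LAPLACIAN IS SINGULAR AT THE DILATED FIELD** — inside its own holomorphy polydisc: `Δ_eff(a♯1, (a♯1)⁻¹)` is NOT invertible (`B` is singular there by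
PART Ϩ-j, `A` is invertible by the flat window). [cite: King1986, (2.14) p.653, (4.44)–(4.45) p.675; Balaban1985BackgroundPropagators, §3.B p.399 l.37–40, Thm 3.4 p.400] -/
theorem not_isUnit_cxEffLap_slice_dilation :
    ¬ IsUnit (cxEffLap T M a ((L : ℝ) ^ 2) m2 (fun _ : Tor (fine L M) × Fin (d + 1) => (((edgeDil d ((L : ℝ) ^ 2) m2 : ℝ) : 𝕜)) • (1 : Matrix n n 𝕜))
      (fun bd => ((fun _ : Tor (fine L M) × Fin (d + 1) => (((edgeDil d ((L : ℝ) ^ 2) m2 : ℝ) : 𝕜)) • (1 : Matrix n n 𝕜)) bd)⁻¹)) :=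
  not_isUnit_cxEffLap_of_not_isUnit_zero T M (isUnit_cxFullOp_dilation T M hD hL ha hm hmL hsmall) (not_isUnit_cxFullOp_slice_dilation T M hL hm)

/-- ★★★★ **NE2's UNIT LAYER HAS A POLE INSIDE THE HOLOMORPHY POLYDISC OF `Δ_eff`**: for `3√m² ≤ s₀(γ_A,a,d)` there is a complex link field `U` with `‖U_b − 1‖ ≤ 3√m²∕L` on every bond at
which `A(U,U⁻¹)` is invertible and `W ↦ Δ_eff(W,W⁻¹)` is analytic, but `B(U,U⁻¹)` and `Δ_eff(U,U⁻¹)` are both singular — the block-spin mass protects `Δ_eff`, not its inverse.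
[cite: King1986, (2.14) p.653, (4.44)–(4.45) p.675; Balaban1985BackgroundPropagators, §3.B p.399 l.37–40, Thm 3.4 p.400] -/
theorem blockCov_pole_inside_effLap_polydisc :
    ∃ U : Tor (fine L M) × Fin (d + 1) → Matrix n n 𝕜, (∀ bd, ‖U bd - 1‖ ≤ 3 * Real.sqrt m2 / L)
      ∧ IsUnit (cxFullOp T M a ((L : ℝ) ^ 2) m2 U (fun bd => (U bd)⁻¹))
      ∧ AnalyticAt 𝕜 (fun W : Tor (fine L M) × Fin (d + 1) → Matrix n n 𝕜 => cxEffLap T M a ((L : ℝ) ^ 2) m2 W (fun bd => (W bd)⁻¹)) U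
      ∧ ¬ IsUnit (cxFullOp T M 0 ((L : ℝ) ^ 2) m2 U (fun bd => (U bd)⁻¹))
      ∧ ¬ IsUnit (cxEffLap T M a ((L : ℝ) ^ 2) m2 U (fun bd => (U bd)⁻¹)) := by
  have hL0 : (0 : ℝ) < L := by exact_mod_cast hL
  refine ⟨fun _ => (((edgeDil d ((L : ℝ) ^ 2) m2 : ℝ) : 𝕜)) • (1 : Matrix n n 𝕜), fun bd => norm_dilationField_sub_one_le M hL hm hmL bd,
    isUnit_cxFullOp_dilation T M hD hL ha hm hmL hsmall, ?_, not_isUnit_cxFullOp_slice_dilation T M hL hm, not_isUnit_cxEffLap_slice_dilation T M hD hL ha hm hmL hsmall⟩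
  -- analyticity of `Δ_eff` at the dilated field: it lies in the CLOSED polydisc `Lε ≤ s₀(γ_A,a,d)`; use the open polydisc of a slightly smaller concentric closed one?  Directly: PART Ϫ-d at radius `3√m²∕L`
  have hU : ∀ bd, ‖(fun _ : Tor (fine L M) × Fin (d + 1) => (((edgeDil d ((L : ℝ) ^ 2) m2 : ℝ) : 𝕜)) • (1 : Matrix n n 𝕜)) bd - (fun _ => (1 : Matrix n n 𝕜)) bd‖ ≤ 3 * Real.sqrt m2 / L :=
    norm_dilationField_sub_one_le M hL hm hmL
  have hrad : (L : ℝ) * (3 * Real.sqrt m2 / L) ≤ sliceRadius (gamA a (d + 1)) a d := by rw [mul_div_cancel₀ _ hL0.ne']; exact hsmall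
  have hunit := isUnit_links_of_polydisc M hL (U₀ := fun _ => (1 : Matrix n n 𝕜)) (fun _ => Submonoid.one_mem _) hU hrad
  have hA := isUnit_cxFullOp_dilation T M hD hL ha hm hmL hsmall (𝕜 := 𝕜) (n := n)
  have h := (analyticAt_cxEffLap T M (UV₀ := (((fun _ : Tor (fine L M) × Fin (d + 1) => (((edgeDil d ((L : ℝ) ^ 2) m2 : ℝ) : 𝕜)) • (1 : Matrix n n 𝕜)),
      fun bd => ((fun _ : Tor (fine L M) × Fin (d + 1) => (((edgeDil d ((L : ℝ) ^ 2) m2 : ℝ) : 𝕜)) • (1 : Matrix n n 𝕜)) bd)⁻¹) : Covariant.CxLinks (fine L M) 𝕜 n)) hA).comp_of_eq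
    (analyticAt_sliceEmbed M hunit) rfl
  exact h

/-- ★★★ **NO CLOSED POLYDISC OF RADIUS `3√m²∕L` AROUND THE TRIVIAL BACKGROUND IS A WINDOW FOR NE2's UNIT LAYER** (under `3√m² ≤ s₀(γ_A,a,d)`). [cite: Balaban1985BackgroundPropagators, Thm 3.4 p.400; King1986, (4.45) p.675] -/
theorem not_forall_isUnit_cxEffLap_closedPolydisc :
    ¬ ∀ U : Tor (fine L M) × Fin (d + 1) → Matrix n n 𝕜, (∀ bd, ‖U bd - 1‖ ≤ 3 * Real.sqrt m2 / L) → IsUnit (cxEffLap T M a ((L : ℝ) ^ 2) m2 U (fun bd => (U bd)⁻¹)) := by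
  intro h
  obtain ⟨U, hU, _, _, _, hΔ⟩ := blockCov_pole_inside_effLap_polydisc T M hD hL ha hm hmL hsmall (𝕜 := 𝕜) (n := n)
  exact hΔ (h U hU)

omit [Nonempty n] hD hL hmL in
/-- ★★ **THE TWO CERTIFIED ORDERS ARE CONSISTENT**: under the smallness hypothesis the working radius `s₀(m²,a,d)` of PART Ϫ-b is `≤ 3√m²` (indeed `s₀(m²,a,d) ≤ s₀(γ_A,a,d)` would contradict
nothing; directly `s₀(m²,a,d) ≤ m²∕(240(d+1)(1+a)) ≤ m² ≤ 3√m²` once `m² ≤ 9`, which `3√m² ≤ s₀ ≤ 1∕4` forces). [cite: Balaban1985BackgroundPropagators, Thm 3.4 p.400] -/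
theorem blockCov_radius_pinched : sliceRadius m2 a d ≤ 3 * Real.sqrt m2 := by
  have h1 : sliceRadius m2 a d ≤ m2 / (240 * ((d : ℝ) + 1) * (1 + a)) := (sliceRadius_le m2 a d).2
  have hden : 240 * ((d : ℝ) + 1) * (1 + a) ≥ 1 := by have : (0 : ℝ) ≤ d := Nat.cast_nonneg d; nlinarith
  have h2 : m2 / (240 * ((d : ℝ) + 1) * (1 + a)) ≤ m2 := div_le_self hm.le hden
  -- `3√m² ≤ s₀(γ_A,a,d) ≤ 1∕4` ⟹ `√m² ≤ 1∕12` ⟹ `m² ≤ √m²` ⟹ `m² ≤ 3√m²`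
  have hs : Real.sqrt m2 ≤ 1 := by
    have h := hsmall.trans (sliceRadius_le (gamA a (d + 1)) a d).1
    have hd : (1 : ℝ) / (4 * ((d : ℝ) + 1)) ≤ 1 := by
      rw [div_le_iff₀ (by positivity)]; have : (0 : ℝ) ≤ d := Nat.cast_nonneg d; linarith
    linarith
  have hm' : m2 ≤ Real.sqrt m2 := by
    have := Real.sq_sqrt hm.le
    nlinarith [Real.sqrt_nonneg m2]
  linarith

end Pole

end Summit.QuantumFields.YangMills.BalabanUVNodes.N15KingModelRung.Analytic

end
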